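import Mathlib
import Summits.ResolutionOfSingularities.ResolutionOfSingularities.Theses.PAlteration
import Literature.AlgebraicGeometry.Resolution.RegularDerivationQuotient
import Literature.AlgebraicGeometry.Resolution.ExcellentRings

/-!
# ResolutionOfSingularities / pAlteration — `PicoverLocalModel`: the singular locus of `t^p = a`
# lies over `da = 0` (supports stmt-ResolutionOfSingularities-0557)

Route `pAlteration`, crux `PicoverLocalModel` (rank 5): resolution of the reduced local model
`X_a = Spec ((R[T]/(T^p - a))_red)` over a regular finitely generated `k`-domain `R`, `char k = p`.

`PAlterationPicoverLocalModelTransversal.lean` disposed of the GLOBAL transversal case (a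
derivation with `D a` a unit makes `R[T]/(T^p - a)` regular). This file is its POINTWISE form,
the statement every line of attack starts from: **at a prime `𝔓` of `A_a = R[T]/(Tⁿ - a)` such
that some derivation `D` of `R` has `D a ∉ 𝔓 ∩ R`, the local ring `(A_a)_𝔓` is regular**
(`isRegularLocalRing_localModel_of_derivation`). Equivalently, the non-regular locus of `A_a`
lies over the closed subset `V(J_a)` of `Spec R`, `J_a = (D a : D ∈ Der_ℤ(R))` the "Jacobian
ideal of `a`" — the locus `da = 0`, which is where the characteristic-`p` phenomena (kangaroo
points, unbounded residual order) live. Proof: Stacks 07PF made pointwise — `D` extends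
coefficientwise to `R[T]` with `D(Tⁿ - a) = -D a`; for a prime `𝔔 ∋ f` of a ring `C` and a
derivation with `D f ∉ 𝔔`, Leibniz gives `D(𝔔²) ⊆ 𝔔`, hence `f ∉ 𝔔⁽²⁾`, so `C_𝔔/(f)` is
regular when `C_𝔔` is (Matsumura 14.2, in tree as `IsRegularLocalRing.quotient_span_singleton`).

Contents: `mul_notMem_sq_of_derivation_notMem` (Leibniz),
`isRegularLocalRing_localization_quotient_of_derivation` (pointwise 07PF for `C/(f)`),
`isRegularLocalRing_localModel_of_derivation` (the local model),
`compl_regularLocus_localModel_subset` (`Sing ⊆ V(J_a)` as sets of primes). No statement item is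
restated.
-/

-- `Summit.<Summit>.<Sub>.Theorems` with `Sub = Summit` (single-conjunct summit, D-0017).
set_option linter.dupNamespace false

namespace Summit.ResolutionOfSingularities.ResolutionOfSingularities.Theorems

open Polynomial IsLocalRing Literature.AlgebraicGeometry.Resolution

universe u

section PerPrime

variable {C : Type u} [CommRing C]

/-- **Leibniz at a prime.** If `D f ∉ 𝔔` for a derivation `D` and a prime `𝔔 ∋ f`, then no
`u ∉ 𝔔` has `u f ∈ 𝔔²` (i.e. `f ∉ 𝔔⁽²⁾`): `D(𝔔²) ⊆ 𝔔` by the Leibniz rule, while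
`D(uf) ≡ u·D f ∉ 𝔔`. [cite: StacksProject, Tag 07PF] -/
theorem mul_notMem_sq_of_derivation_notMem {S₀ : Type*} [CommSemiring S₀] {_ : Algebra S₀ C}
    (f : C) (D : Derivation S₀ C C) (Q : Ideal C) [Q.IsPrime] (hfQ : f ∈ Q) (hDQ : D f ∉ Q)
    {u : C} (hu : u ∉ Q) : u * f ∉ Q ^ 2 := by
  intro huf
  have key : ∀ x ∈ Q ^ 2, D x ∈ Q := by
    intro x hx
    rw [pow_two] at hx
    refine Submodule.mul_induction_on hx (fun a ha b hb => ?_) (fun a b ha hb => ?_)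
    · rw [Derivation.leibniz, smul_eq_mul, smul_eq_mul]
      exact Q.add_mem (Q.mul_mem_right _ ha) (Q.mul_mem_right _ hb)
    · rw [map_add]
      exact Q.add_mem ha hb
  have h1 : D (u * f) ∈ Q := key _ huf
  rw [Derivation.leibniz, smul_eq_mul, smul_eq_mul] at h1
  have h2 : u * D f ∈ Q := (Ideal.add_mem_iff_left Q (Q.mul_mem_right _ hfQ)).mp h1
  exact hDQ ((Ideal.IsPrime.mem_or_mem ‹_› h2).resolve_left hu)

/-- **Stacks 07PF at one prime.** Let `f ∈ C`, `D` a derivation of `C`, and `𝔓` a prime of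
`C/(f)` with preimage `𝔔 ∋ f`. If `C_𝔔` is a regular local ring and `D f ∉ 𝔔`, then
`(C/(f))_𝔓 = C_𝔔/(f)` is a regular local ring (`f ∈ 𝔔C_𝔔 ∖ 𝔔²C_𝔔` by
`mul_notMem_sq_of_derivation_notMem`, then Matsumura Thm. 14.2). [cite: StacksProject, Tag 07PF] -/
theorem isRegularLocalRing_localization_quotient_of_derivation {S₀ : Type*} [CommSemiring S₀]
    {_ : Algebra S₀ C} (f : C) (D : Derivation S₀ C C) (P : Ideal (C ⧸ Ideal.span {f}))
    [P.IsPrime]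
    [IsRegularLocalRing (Localization.AtPrime (P.comap (Ideal.Quotient.mk (Ideal.span {f}))))]
    (hD : D f ∉ P.comap (Ideal.Quotient.mk (Ideal.span {f}))) :
    IsRegularLocalRing (Localization.AtPrime P) := by
  set Q : Ideal C := P.comap (Ideal.Quotient.mk (Ideal.span {f})) with hQdef
  haveI hQ : Q.IsPrime := Ideal.comap_isPrime _ P
  have hf0 : Ideal.Quotient.mk (Ideal.span {f}) f = 0 :=
    Ideal.Quotient.eq_zero_iff_mem.mpr (Ideal.subset_span (Set.mem_singleton f))
  have hfQ : f ∈ Q := by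
    change Ideal.Quotient.mk (Ideal.span {f}) f ∈ P
    rw [hf0]
    exact P.zero_mem
  -- `f ∈ 𝔪 ∖ 𝔪²` in the regular local ring `C_Q`
  have hfm : algebraMap C (Localization.AtPrime Q) f ∈ maximalIdeal (Localization.AtPrime Q) := by
    rw [← Localization.AtPrime.map_eq_maximalIdeal]
    exact Ideal.mem_map_of_mem _ hfQ
  have hfm2 : algebraMap C (Localization.AtPrime Q) f ∉
      maximalIdeal (Localization.AtPrime Q) ^ 2 := by
    rw [← Localization.AtPrime.map_eq_maximalIdeal, ← Ideal.map_pow,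
      IsLocalization.algebraMap_mem_map_algebraMap_iff Q.primeCompl]
    rintro ⟨u, hu, huf⟩
    exact mul_notMem_sq_of_derivation_notMem f D Q hfQ hD hu huf
  have hreg : IsRegularLocalRing
      (Localization.AtPrime Q ⧸ Ideal.span {algebraMap C (Localization.AtPrime Q) f}) :=
    (IsRegularLocalRing.quotient_span_singleton hfm hfm2).1
  have hmap : (Ideal.span {f}).map (algebraMap C (Localization.AtPrime Q)) =
      Ideal.span {algebraMap C (Localization.AtPrime Q) f} := by
    rw [Ideal.map_span, Set.image_singleton]
  -- `(C/(f))_P ≅ C_Q/(f)`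
  have hsub : Algebra.algebraMapSubmonoid (C ⧸ Ideal.span {f}) Q.primeCompl = P.primeCompl := by
    ext x
    constructor
    · rintro ⟨c, hc, rfl⟩
      exact hc
    · intro hx
      obtain ⟨c, rfl⟩ := Ideal.Quotient.mk_surjective x
      exact ⟨c, hx, rfl⟩
  haveI : IsLocalization.AtPrime
      (Localization.AtPrime Q ⧸ (Ideal.span {f}).map (algebraMap C (Localization.AtPrime Q)))
      P := by
    change IsLocalization P.primeCompl _
    rw [← hsub]
    infer_instance
  let e : Localization.AtPrime P ≃ₐ[C ⧸ Ideal.span {f}]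
      Localization.AtPrime Q ⧸ (Ideal.span {f}).map (algebraMap C (Localization.AtPrime Q)) :=
    IsLocalization.algEquiv P.primeCompl _ _
  let e' : (Localization.AtPrime Q ⧸ (Ideal.span {f}).map (algebraMap C (Localization.AtPrime Q)))
      ≃+* Localization.AtPrime Q ⧸ Ideal.span {algebraMap C (Localization.AtPrime Q) f} :=
    Ideal.quotEquivOfEq hmap
  haveI := hreg
  exact IsRegularLocalRing.of_ringEquiv (e.toRingEquiv.trans e').symm

end PerPrime

/-! ## The local model `R[T]/(Tⁿ - a)` -/

section LocalModel

variable {R : Type u} [CommRing R]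

/-- **The singular locus of `tⁿ = a` lies over `da = 0`.** Let `R` be a regular ring, `a ∈ R`,
`n` any exponent, and `𝔓` a prime of `A_a = R[T]/(Tⁿ - a)`. If some derivation `D` of `R` has
`D a ∉ 𝔓 ∩ R`, then `(A_a)_𝔓` is a regular local ring: `R[T]` is regular, the coefficientwise
extension of `D` maps `Tⁿ - a` to `-D a ∉ 𝔓`, and Stacks 07PF applies at `𝔓`. (For `n = p` the
characteristic: the non-regular points of the `α_p`-torsor `t^p = a` all lie over
`V(D a : D ∈ Der(R))`.) [cite: StacksProject, Tag 07PG] -/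
theorem isRegularLocalRing_localModel_of_derivation [IsRegularRing R] (D : Derivation ℤ R R)
    (a : R) (n : ℕ) (P : Ideal (AdjoinRoot ((X : R[X]) ^ n - C a))) [P.IsPrime]
    (hP : D a ∉ P.comap (AdjoinRoot.of ((X : R[X]) ^ n - C a))) :
    IsRegularLocalRing (Localization.AtPrime P) := by
  letI : Differential R := ⟨D⟩
  -- view `P` as an ideal of the quotient `R[T]/(Tⁿ - a)` (this is `AdjoinRoot` by definition)
  let P' : Ideal (R[X] ⧸ Ideal.span {(X : R[X]) ^ n - C a}) := P
  haveI hP' : P'.IsPrime := ‹P.IsPrime›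
  -- the preimage of `P` in `R[T]` is a prime of the regular ring `R[T]`
  haveI : (P'.comap (Ideal.Quotient.mk (Ideal.span {(X : R[X]) ^ n - C a}))).IsPrime :=
    Ideal.comap_isPrime _ P'
  haveI : IsRegularLocalRing (Localization.AtPrime
      (P'.comap (Ideal.Quotient.mk (Ideal.span {(X : R[X]) ^ n - C a})))) := inferInstance
  have key : IsRegularLocalRing (Localization.AtPrime P') := by
    refine isRegularLocalRing_localization_quotient_of_derivation ((X : R[X]) ^ n - C a)
      (Differential.mapCoeffs : Derivation ℤ R[X] R[X]) P' ?_
    rw [mapCoeffs_X_pow_sub_C, neg_mem_iff, Ideal.mem_comap]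
    intro h
    apply hP
    rw [Ideal.mem_comap]
    exact h
  exact key

/-- **`Sing(X_a) ⊆ V(J_a)`.** For a regular ring `R`, the complement of the regular locus of
`A_a = R[T]/(Tⁿ - a)` lies in the preimage of the zero locus `V(J_a) ⊆ Spec R` of the Jacobian
ideal `J_a = (D a : D ∈ Der_ℤ(R))` of `a`. [cite: StacksProject, Tag 07PG] -/
theorem compl_regularLocus_localModel_subset [IsRegularRing R] (a : R) (n : ℕ) :
    (regularLocus (AdjoinRoot ((X : R[X]) ^ n - C a)))ᶜ ⊆
      PrimeSpectrum.comap (AdjoinRoot.of ((X : R[X]) ^ n - C a)) ⁻¹'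
        PrimeSpectrum.zeroLocus (Set.range fun D : Derivation ℤ R R => D a) := by
  intro P hP
  rw [Set.mem_preimage, PrimeSpectrum.mem_zeroLocus]
  rintro _ ⟨D, rfl⟩
  by_contra hD
  exact hP (isRegularLocalRing_localModel_of_derivation D a n P.asIdeal hD)

end LocalModel

end Summit.ResolutionOfSingularities.ResolutionOfSingularities.Theorems
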